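import Summits.QuantumFields.YangMills.Theorems.UnitScaleTiltProp8HalvingLastMile
import HarnessLib

/-!
# Route `UnitScaleTilt`, crux K1 child «MinimiserStabilityRegPr» (stmt-QuantumFields-19200), registered stub V2′ `stub_halvingStep`
# (skeleton v7 cc37a17877262141) — **THE TORUS ⇄ `ℤᵈ`-PULLBACK DICTIONARY OF THE HALVING SOCKET AT THE FLAT BACKGROUND**:
# the chart equation «U^{u⁻¹} = e^{iηA}» and the three members of [Balaban1985RegularSpaces] (1.140) (`|A|`, `|∇^ηA|`, `|∂^{η*}∂^ηA|`)
# of the socket `Prop8LastMile.halvingLiteral_of_localCharts167` (p582419; F2's pullback letters) READ ON THE TORUS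

Cell `ym3-torus` (HUMAN RULING D-0037, YM ladder rung R3 — continuum SU(2) YM₃ on the torus is a RUNG, not the Clay problem), width seat
`ym-ust-19200-w3` gen 0.  `--supports stmt-QuantumFields-19200 --as helper`; def-free, 0 sorry, standard axioms.  NOTHING of Bałaban's is
asserted: this file only unfolds lit-balaban's `ℤᵈ` letters (`B7Eq92Concrete.mgauge`, `B8Eq184Proof.cfgExp`, `B8Ineq132.covDerivFwd`/`covDeriv`,
`B8Eq146AExpansion.plaqCovDeriv`, `B8Eq143PlaqExpansion.pdiv`) at the flat background `1♯ = cfgPull P 1` on the periodic pullbacks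
`U♯ = cfgPull P U`, `u♯ = gaugePull P u`, `A♯ = pull A 0` of TORUS objects, so that a supplier of the (167)-charts working with torus-native
fields (the F4/P2/P5 lineages: `PBond (F.P K) 0 → M₂(ℂ)`) meets the socket's hypotheses by torus-native bond identities and bounds.

WHY (HALVING-SOCKET-w3g0.md §4(e), 19200 evidence #47): the socket's hypothesis `H` asks, around every site, for (i) the chart equation
`mgauge 1♯ (u♯)⁻¹ U♯ = cfgExp η A♯` on the `SideTouches` layers and (ii) `Cond140 L η α₂ j (pullDom Ω j) 1♯ A♯`; the B8 lane's Theorem-2 shape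
`B8Thm2SetupTorus.Concl2Setup` delivers (i) literally, but the IMPROVED size (167) of (ii) is computed torus-natively ((158)–(165), F4 by name), so
the three members of (1.140) must be read back on the torus — at the flat background they are plain first and second DIFFERENCES of `A` along
torus bonds (`Site.shift`/`Site.unshift`), which is what this file certifies.

WHAT THIS FILE PROVES (`P : Params`, `N`, torus objects `U`, `u`, `A`; `y := transl 0 z` the torus site under the `ℤᵈ` point `z`):
* §1 `cfgPull_one` (`1♯ = 1`), `mgauge_flat_pull_apply` — «U^{u⁻¹}» at `(z, μ)` IS `(u(y))⁻¹·U(⟨y, μ⟩)·u(y + e_μ)` (units of `M_N(ℂ)`),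
  `cfgExp_pull_apply` — `e^{iηA♯}(z, μ) = expUnit (iη·A⟨y, μ⟩)`; `chart_pull_of_torus` — the torus bond identity
  `(u b₋)⁻¹·U(b)·u(b₊) = expUnit (iηA(b))` at `b = ⟨y, μ⟩` gives the socket's chart equation at `(z, μ)`.
* §2 `covDerivFwd_flat_pull_apply` — `(∇^η_{1,κ}A♯_τ)(z) = η⁻¹(A⟨y + e_κ, τ⟩ − A⟨y, τ⟩)`; `covDeriv_flat_pull_apply` — the backward one with `y − e_ν`;
  `plaqCovDeriv_flat_pull_apply` — `(∂^ηA♯)(p_{μν}(z)) = η⁻¹(A⟨y+e_μ, ν⟩ − A⟨y, ν⟩) − η⁻¹(A⟨y+e_ν, μ⟩ − A⟨y, μ⟩)`;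
  `pdiv_flat_apply` — `(∂^{η*}G)_μ(z) = Σ_{ν<μ} η⁻¹(G_{νμ}(z − e_ν) − G_{νμ}(z)) − Σ_{ν>μ} η⁻¹(G_{μν}(z − e_ν) − G_{μν}(z))` at the flat background.
* §3 `cond140_flat_pull_of_torus` — **(1.140) AT THE FLAT BACKGROUND FROM TORUS-NATIVE BOUNDS**: if for every `(z, τ)` in the `SideTouches` layer
  of `pullDom Ω j` the torus one-form obeys `‖A⟨y, τ⟩‖ < α₂(Lʲη)⁻¹` and `‖η⁻¹(A⟨y + e_κ, τ⟩ − A⟨y, τ⟩)‖ < α₂((Lʲη)⁻¹)²` (all `κ`), and for every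
  `(z, μ)` in the `BondTouches` layer the flat `∂^{η*}∂^η` expression (§2, written in torus differences) is `< α₂((Lʲη)⁻¹)³`, then
  `Cond140 P.L η α₂ j (pullDom Ω j) (cfgPull P 1) (pull A 0)`.
* §4 `localChart_of_torus` — §1 + §3 packaged in the socket's per-site shape: torus-native chart identity and bounds on a family `Ω ∋ x` ⇒ the
  `∃ Ω u A, …` clause of `Prop8LastMile.regPr_of_localCharts` / `halvingMinimisers_of_localCharts167` at the site `x`.
* §5 (v1.1, append-only) `localChart_top_of_torus` — the one-set top-level form (print's `Δ₀`): thresholds literally `α₂` (`(Lᵏη)⁻¹ = 1`,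
  `topScale_inv_eq_one`).  §6 `localChart_top_one` — NON-VACUITY: `U = 1` meets the clause with `u = 1`, `A = 0`, every `α₂ > 0`.

HONEST SCOPE: pure unfolding/bookkeeping (no estimate of Bałaban's is proved); the `SideTouches`/`BondTouches` predicates of the pulled-back
regions are kept as the supplier's bookkeeping (their torus transport is `B8Thm2SetupTorus.bondTouches_pullSet_iff` / `plaqTouches_pullSet_iff`).
No definition, no sorry, standard axioms.  NOT a claim about the crux, the rung, or the mass gap.

References: T. Bałaban, CMP **99** (1985) 75–102 [Balaban1985RegularSpaces] (1.1) p.76, (1.16)–(1.17) p.78, (1.69) p.88, (1.140) p.100;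
CMP **98** (1985) 17–51 [Balaban1985Averaging] (55)–(56) p.27; CMP **102** (1985) 277–309 [Balaban1985Variational] (152) p.301, (167) p.304.
-/

set_option autoImplicit false

noncomputable section

open scoped Matrix.Norms.L2Operator BigOperators

namespace Summit.QuantumFields.YangMills.Theorems.Prop8PullbackDict

open Literature.MathematicalPhysics.QuantumFieldTheory.Balaban1983to89
open Complex (I)
open B7Prop1Explicit (e expUnit)
open B7Eq78Linearization (conjR conjR_apply)
open B7Eq92Concrete (mgauge Rc)
open B8Ineq132 (covDerivFwd covDeriv BondTouches)
open B8Eq140Level (SideTouches Cond140)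
open B8Eq143PlaqExpansion (pdiv)
open B8Eq146AExpansion (plaqCovDeriv)
open B8Eq184Proof (cfgExp)
open B8Thm2SetupTorus (cfgPull gaugePull pullDom cfgPull_apply gaugePull_apply)
open B10Eq27TorusAxialLog (pull unitsField transl transl_add_e transl_sub_e pull_apply)

variable {P : Params} {N : ℕ} [NeZero N]

/-! ## §1 The chart equation «U^{u⁻¹} = e^{iηA}» on the torus -/

/-- The flat background pulls back to the flat `ℤᵈ` configuration: `1♯ = 1`. [cite: Balaban1985RegularSpaces, (1.3) p.77] -/
theorem cfgPull_one : cfgPull P (1 : GaugeField P 0 (Matrix.unitaryGroup (Fin N) ℂ)) = 1 := by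
  funext z μ
  rw [cfgPull_apply, B10Eq68TorusRegularity.unitsField_one]
  rfl

/-- **«U^{u⁻¹}» READ ON THE TORUS**: at the flat background the moving-frame gauge transform of `U♯` by `(u♯)⁻¹` at `(z, μ)` is
`(u(y))⁻¹·U⟨y, μ⟩·u(y + e_μ)`, `y = transl 0 z` (units of `M_N(ℂ)`). [cite: Balaban1985Averaging, (55)-(56) p.27; Balaban1985RegularSpaces, (1.16)-(1.17) p.78] -/
theorem mgauge_flat_pull_apply (U : GaugeField P 0 (Matrix.unitaryGroup (Fin N) ℂ)) (u : GaugeTransf P 0 (Matrix.unitaryGroup (Fin N) ℂ))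
    (z : B7Prop1Explicit.Site P.d) (μ : Fin P.d) :
    mgauge (cfgPull P 1) (gaugePull P u)⁻¹ (cfgPull P U) z μ =
      (Unitary.toUnits (u (transl 0 z)))⁻¹ * unitsField U ⟨transl 0 z, μ⟩ * Unitary.toUnits (u ((transl 0 z).shift μ)) := by
  rw [B7Eq92Concrete.mgauge_apply, cfgPull_one, Pi.inv_apply, Pi.inv_apply, gaugePull_apply, gaugePull_apply, cfgPull_apply, transl_add_e]
  simp only [Pi.one_apply, B7Eq92Concrete.Rc_apply, one_mul, inv_one, mul_one, inv_inv]

omit [NeZero N] in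
/-- **`e^{iηA♯}` READ ON THE TORUS**: `cfgExp η A♯ (z, μ) = expUnit (iη·A⟨y, μ⟩)`. [cite: Balaban1985RegularSpaces, (1.69) p.88] -/
theorem cfgExp_pull_apply (η : ℝ) (A : GaugeField P 0 (Matrix (Fin N) (Fin N) ℂ)) (z : B7Prop1Explicit.Site P.d) (μ : Fin P.d) :
    cfgExp η (pull A 0) z μ = expUnit (I • (η • A ⟨transl 0 z, μ⟩)) := rfl

/-- **THE SOCKET's CHART EQUATION FROM A TORUS BOND IDENTITY**: if at the torus bond `b = ⟨y, μ⟩`, `y = transl 0 z`, one has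
`(u b₋)⁻¹·U(b)·u(b₊) = expUnit (iηA(b))`, then `mgauge 1♯ (u♯)⁻¹ U♯ (z, μ) = cfgExp η A♯ (z, μ)`.
[cite: Balaban1985RegularSpaces, (1.16) p.78, (1.69) p.88; Balaban1985Variational, (152) p.301] -/
theorem chart_pull_of_torus {η : ℝ} {U : GaugeField P 0 (Matrix.unitaryGroup (Fin N) ℂ)} {u : GaugeTransf P 0 (Matrix.unitaryGroup (Fin N) ℂ)}
    {A : GaugeField P 0 (Matrix (Fin N) (Fin N) ℂ)} {z : B7Prop1Explicit.Site P.d} {μ : Fin P.d}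
    (h : (Unitary.toUnits (u (transl 0 z)))⁻¹ * unitsField U ⟨transl 0 z, μ⟩ * Unitary.toUnits (u ((transl 0 z).shift μ)) =
      expUnit (I • (η • A ⟨transl 0 z, μ⟩))) :
    mgauge (cfgPull P 1) (gaugePull P u)⁻¹ (cfgPull P U) z μ = cfgExp η (pull A 0) z μ := by
  rw [mgauge_flat_pull_apply, cfgExp_pull_apply, h]

/-! ## §2 The three members of (1.140) at the flat background, read on the torus -/

section Derivatives

variable {𝔸 : Type*} [NormedRing 𝔸] [NormedAlgebra ℂ 𝔸]

/-- **FORWARD DERIVATIVE** ([B8] (1.1), first line) at the flat background on a pulled-back torus function: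
`(∇^η_{1,κ}f♯)(z) = η⁻¹(f(y + e_κ) − f(y))`. [cite: Balaban1985RegularSpaces, (1.1) p.76] -/
theorem covDerivFwd_flat_apply (η : ℝ) (κ : Fin P.d) (f : Site P 0 → 𝔸) (z : B7Prop1Explicit.Site P.d) :
    covDerivFwd η (1 : B7Prop1Explicit.Site P.d → Fin P.d → 𝔸ˣ) κ (fun w => f (transl 0 w)) z =
      η⁻¹ • (f ((transl 0 z).shift κ) - f (transl 0 z)) := by
  simp only [covDerivFwd, Pi.one_apply, conjR_apply, Units.val_one, inv_one, one_mul, mul_one, transl_add_e]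

/-- **BACKWARD DERIVATIVE** ([B8] (1.1), second line) at the flat background: `(D^{η*}_{1,ν}f♯)(z) = η⁻¹(f(y − e_ν) − f(y))`.
[cite: Balaban1985RegularSpaces, (1.1) p.76] -/
theorem covDeriv_flat_apply (η : ℝ) (ν : Fin P.d) (f : Site P 0 → 𝔸) (z : B7Prop1Explicit.Site P.d) :
    covDeriv η (1 : B7Prop1Explicit.Site P.d → Fin P.d → 𝔸ˣ) ν (fun w => f (transl 0 w)) z =
      η⁻¹ • (f ((transl 0 z).unshift ν) - f (transl 0 z)) := by
  simp only [covDeriv, Pi.one_apply, inv_one, conjR_apply, Units.val_one, one_mul, mul_one, transl_sub_e]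

end Derivatives

/-- The flat background of §1 as the `𝔸ˣ`-valued constant `1` of §2 (for rewriting `Cond140 … (cfgPull P 1) …`). [cite: Balaban1985RegularSpaces, (1.3) p.77] -/
theorem cond140_cfgPull_one_iff (η α₂ : ℝ) (j : ℕ) (S : Set (B7Prop1Explicit.Site P.d)) (A : B7Prop1Explicit.Site P.d → Fin P.d → Matrix (Fin N) (Fin N) ℂ) :
    Cond140 P.L η α₂ j S (cfgPull P (1 : GaugeField P 0 (Matrix.unitaryGroup (Fin N) ℂ))) A ↔
      Cond140 P.L η α₂ j S (1 : B7Prop1Explicit.Site P.d → Fin P.d → (Matrix (Fin N) (Fin N) ℂ)ˣ) A := by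
  rw [cfgPull_one]

omit [NeZero N] in
/-- **(1.140)₁ member `∇^η`**: the forward derivative of the `τ`-component of `A♯` at the flat background, on the torus.
[cite: Balaban1985RegularSpaces, (1.140) p.100, (1.1) p.76] -/
theorem covDerivFwd_flat_pull_apply (η : ℝ) (κ τ : Fin P.d) (A : GaugeField P 0 (Matrix (Fin N) (Fin N) ℂ)) (z : B7Prop1Explicit.Site P.d) :
    covDerivFwd η (1 : B7Prop1Explicit.Site P.d → Fin P.d → (Matrix (Fin N) (Fin N) ℂ)ˣ) κ (fun w => pull A 0 w τ) z =
      η⁻¹ • (A ⟨(transl 0 z).shift κ, τ⟩ - A ⟨transl 0 z, τ⟩) :=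
  covDerivFwd_flat_apply η κ (fun y => A ⟨y, τ⟩) z

omit [NeZero N] in
/-- **THE FLAT CURL `∂^ηA♯` ON THE TORUS** ([B9] (3.4) at the trivial background):
`(∂^ηA♯)(p_{μν}(z)) = η⁻¹(A⟨y + e_μ, ν⟩ − A⟨y, ν⟩) − η⁻¹(A⟨y + e_ν, μ⟩ − A⟨y, μ⟩)`. [cite: Balaban1985RegularSpaces, (1.1)-(1.2) p.76] -/
theorem plaqCovDeriv_flat_pull_apply (η : ℝ) (A : GaugeField P 0 (Matrix (Fin N) (Fin N) ℂ)) (μ ν : Fin P.d) (z : B7Prop1Explicit.Site P.d) :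
    plaqCovDeriv η (1 : B7Prop1Explicit.Site P.d → Fin P.d → (Matrix (Fin N) (Fin N) ℂ)ˣ) (pull A 0) μ ν z =
      η⁻¹ • (A ⟨(transl 0 z).shift μ, ν⟩ - A ⟨transl 0 z, ν⟩) - η⁻¹ • (A ⟨(transl 0 z).shift ν, μ⟩ - A ⟨transl 0 z, μ⟩) := by
  rw [B8Eq146AExpansion.plaqCovDeriv_eq_covDerivFwd]
  simp only [covDerivFwd, Pi.one_apply, conjR_apply, Units.val_one, inv_one, one_mul, mul_one, pull_apply, transl_add_e]

omit [NeZero N] in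
/-- **THE FLAT DIVERGENCE `∂^{η*}` OF A PLAQUETTE FUNCTION**: `(∂^{η*}G)_μ(z) = Σ_{ν<μ} η⁻¹(G_{νμ}(z − e_ν) − G_{νμ}(z)) − Σ_{ν>μ} η⁻¹(G_{μν}(z − e_ν) − G_{μν}(z))`.
[cite: Balaban1985RegularSpaces, (1.1) p.76, (1.9) p.77] -/
theorem pdiv_flat_apply (η : ℝ) (G : Fin P.d → Fin P.d → B7Prop1Explicit.Site P.d → Matrix (Fin N) (Fin N) ℂ) (μ : Fin P.d)
    (z : B7Prop1Explicit.Site P.d) :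
    pdiv η (1 : B7Prop1Explicit.Site P.d → Fin P.d → (Matrix (Fin N) (Fin N) ℂ)ˣ) G μ z =
      ∑ ν ∈ Finset.Iio μ, η⁻¹ • (G ν μ (z - e ν) - G ν μ z) - ∑ ν ∈ Finset.Ioi μ, η⁻¹ • (G μ ν (z - e ν) - G μ ν z) := by
  simp only [pdiv, covDeriv, Pi.one_apply, inv_one, conjR_apply, Units.val_one, one_mul, mul_one]

/-! ## §3 (1.140) at the flat background from torus-native bounds -/

/-- **[B8] (1.140) AT THE FLAT BACKGROUND FROM TORUS-NATIVE BOUNDS** on the pulled-back region `S = pullDom Ω j` (or any `S`): the sup member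
from `‖A⟨y, τ⟩‖`, the gradient member from the torus forward differences, the second-order member from the flat `∂^{η*}∂^ηA♯` written with
§2's torus formulas (the supplier bounds the displayed expression). [cite: Balaban1985RegularSpaces, (1.140) p.100; Balaban1985Variational, (167) p.304] -/
theorem cond140_flat_pull_of_torus {η α₂ : ℝ} {j : ℕ} (S : Set (B7Prop1Explicit.Site P.d)) (A : GaugeField P 0 (Matrix (Fin N) (Fin N) ℂ))
    (h1 : ∀ (z : B7Prop1Explicit.Site P.d) (τ : Fin P.d), SideTouches S z τ → ‖A ⟨transl 0 z, τ⟩‖ < α₂ * ((P.L : ℝ) ^ j * η)⁻¹)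
    (h2 : ∀ (z : B7Prop1Explicit.Site P.d) (κ τ : Fin P.d), SideTouches S z τ →
      ‖η⁻¹ • (A ⟨(transl 0 z).shift κ, τ⟩ - A ⟨transl 0 z, τ⟩)‖ < α₂ * (((P.L : ℝ) ^ j * η)⁻¹) ^ 2)
    (h3 : ∀ (z : B7Prop1Explicit.Site P.d) (μ : Fin P.d), BondTouches S z μ →
      ‖pdiv η (1 : B7Prop1Explicit.Site P.d → Fin P.d → (Matrix (Fin N) (Fin N) ℂ)ˣ)
          (plaqCovDeriv η (1 : B7Prop1Explicit.Site P.d → Fin P.d → (Matrix (Fin N) (Fin N) ℂ)ˣ) (pull A 0)) μ z‖ <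
        α₂ * (((P.L : ℝ) ^ j * η)⁻¹) ^ 3) :
    Cond140 P.L η α₂ j S (cfgPull P (1 : GaugeField P 0 (Matrix.unitaryGroup (Fin N) ℂ))) (pull A 0) := by
  rw [cond140_cfgPull_one_iff]
  refine ⟨fun z τ hz => ?_, fun z κ τ hz => ?_, fun z μ hz => h3 z μ hz⟩
  · rw [pull_apply]; exact h1 z τ hz
  · rw [covDerivFwd_flat_pull_apply]; exact h2 z κ τ hz

/-! ## §4 The socket's per-site clause from torus-native data -/

/-- **THE SOCKET's PER-SITE CLAUSE FROM TORUS-NATIVE DATA**: a domain family `Ω ∋ x` at the top level `k`, a torus gauge transformation `u`,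
a bondwise self-adjoint torus one-form `A` with the torus bond identity `(u b₋)⁻¹U(b)u(b₊) = expUnit (iηA(b))` on the `SideTouches` layers and the
torus-native (1.140)-bounds of §3 at size `α₂` on every `pullDom Ω j`, `j ≤ k`, give the `∃ Ω u A, …` clause of
`Prop8LastMile.regPr_of_localCharts` / `halvingMinimisers_of_localCharts167` at `x`. [cite: Balaban1985Variational, (152) p.301, (167)–(168) p.304] -/
theorem localChart_of_torus (F : T3ContinuumYM3Torus.T3Family) (n K : ℕ) {α₂ : ℝ} (x : Site (F.P K) 0)
    (U : GaugeField (F.P K) 0 (Matrix.specialUnitaryGroup (Fin 2) ℂ))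
    (Ω : ℕ → Set (Site (F.P K) 0)) (u : GaugeTransf (F.P K) 0 (Matrix.unitaryGroup (Fin 2) ℂ))
    (A : GaugeField (F.P K) 0 (Matrix (Fin 2) (Fin 2) ℂ)) (hx : x ∈ Ω (K - n)) (hA : ∀ b : PBond (F.P K) 0, IsSelfAdjoint (A b))
    (hchart : ∀ j, j ≤ K - n → ∀ (z : B7Prop1Explicit.Site (F.P K).d) (μ : Fin (F.P K).d), SideTouches (pullDom Ω j) z μ →
      (Unitary.toUnits (u (transl 0 z)))⁻¹ * unitsField (B10Eq27TorusAxialLog.toUField U) ⟨transl 0 z, μ⟩ *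
          Unitary.toUnits (u ((transl 0 z).shift μ)) =
        expUnit (I • ((((F.L : ℝ)⁻¹) ^ (K - n)) • A ⟨transl 0 z, μ⟩)))
    (h1 : ∀ j, j ≤ K - n → ∀ (z : B7Prop1Explicit.Site (F.P K).d) (τ : Fin (F.P K).d), SideTouches (pullDom Ω j) z τ →
      ‖A ⟨transl 0 z, τ⟩‖ < α₂ * (((F.P K).L : ℝ) ^ j * ((F.L : ℝ)⁻¹) ^ (K - n))⁻¹)
    (h2 : ∀ j, j ≤ K - n → ∀ (z : B7Prop1Explicit.Site (F.P K).d) (κ τ : Fin (F.P K).d), SideTouches (pullDom Ω j) z τ →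
      ‖(((F.L : ℝ)⁻¹) ^ (K - n))⁻¹ • (A ⟨(transl 0 z).shift κ, τ⟩ - A ⟨transl 0 z, τ⟩)‖ <
        α₂ * ((((F.P K).L : ℝ) ^ j * ((F.L : ℝ)⁻¹) ^ (K - n))⁻¹) ^ 2)
    (h3 : ∀ j, j ≤ K - n → ∀ (z : B7Prop1Explicit.Site (F.P K).d) (μ : Fin (F.P K).d), BondTouches (pullDom Ω j) z μ →
      ‖pdiv (((F.L : ℝ)⁻¹) ^ (K - n)) (1 : B7Prop1Explicit.Site (F.P K).d → Fin (F.P K).d → (Matrix (Fin 2) (Fin 2) ℂ)ˣ)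
          (plaqCovDeriv (((F.L : ℝ)⁻¹) ^ (K - n)) (1 : B7Prop1Explicit.Site (F.P K).d → Fin (F.P K).d → (Matrix (Fin 2) (Fin 2) ℂ)ˣ)
            (pull A 0)) μ z‖ <
        α₂ * ((((F.P K).L : ℝ) ^ j * ((F.L : ℝ)⁻¹) ^ (K - n))⁻¹) ^ 3) :
    ∃ (Ω' : ℕ → Set (Site (F.P K) 0)) (u' : GaugeTransf (F.P K) 0 (Matrix.unitaryGroup (Fin 2) ℂ))
        (A' : GaugeField (F.P K) 0 (Matrix (Fin 2) (Fin 2) ℂ)),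
        x ∈ Ω' (K - n) ∧ (∀ b : PBond (F.P K) 0, IsSelfAdjoint (A' b)) ∧
        (∀ j, j ≤ K - n → ∀ (z : B7Prop1Explicit.Site (F.P K).d) (μ : Fin (F.P K).d), SideTouches (pullDom Ω' j) z μ →
          mgauge (cfgPull (F.P K) 1) (gaugePull (F.P K) u')⁻¹ (cfgPull (F.P K) (B10Eq27TorusAxialLog.toUField U)) z μ =
            cfgExp (((F.L : ℝ)⁻¹) ^ (K - n)) (pull A' 0) z μ) ∧
        (∀ j, j ≤ K - n → Cond140 (F.P K).L (((F.L : ℝ)⁻¹) ^ (K - n)) α₂ j (pullDom Ω' j) (cfgPull (F.P K) 1) (pull A' 0)) := by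
  refine ⟨Ω, u, A, hx, hA, fun j hj z μ hz => ?_, fun j hj => ?_⟩
  · exact chart_pull_of_torus (hchart j hj z μ hz)
  · exact cond140_flat_pull_of_torus (pullDom Ω j) A (h1 j hj) (h2 j hj) (h3 j hj)

/-! ## §5 (v1.1, append-only) The one-set, top-level form: thresholds literally `α₂` (`Lᵏη = 1`) -/

section TopLevel

open Summit.QuantumFields.YangMills.Theorems.Prop8LastMile (topFam_apply_lt pullDom_empty not_sideTouches_pullDom_empty)

/-- At the top scale `k = K − n` the threshold unit is `(Lᵏη)⁻¹ = 1` (`η = L^{−k}`). [cite: Balaban1985Variational, (5) p.278 («η = L⁻ᵏ»)] -/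
theorem topScale_inv_eq_one (F : T3ContinuumYM3Torus.T3Family) (n K : ℕ) :
    (((F.P K).L : ℝ) ^ (K - n) * ((F.L : ℝ)⁻¹) ^ (K - n))⁻¹ = 1 := by
  have hL : ((F.P K).L : ℝ) = (F.L : ℝ) := rfl
  have hL0 : (F.L : ℝ) ≠ 0 := by exact_mod_cast (ne_of_gt (lt_trans zero_lt_one F.hL.2))
  rw [hL, ← mul_pow, mul_inv_cancel₀ hL0, one_pow, inv_one]

/-- No `ℤᵈ` bond touches the pulled-back empty region. [cite: Balaban1985RegularSpaces, p.77 (convention before (1.5))] -/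
theorem not_bondTouches_pullDom_empty (F : T3ContinuumYM3Torus.T3Family) (K : ℕ) (Ω : ℕ → Set (Site (F.P K) 0)) {j : ℕ}
    (hj : Ω j = ∅) (z : B7Prop1Explicit.Site (F.P K).d) (μ : Fin (F.P K).d) : ¬ BondTouches (pullDom Ω j) z μ := by
  rw [pullDom_empty F K Ω hj]
  rintro (h | h) <;> exact h

/-- **THE SOCKET's PER-SITE CLAUSE FROM TORUS-NATIVE DATA ON ONE SET AT THE TOP LEVEL** (print's `Δ₀ = Bᵏ(y) ∋ x`; family `∅` below `k`,
`S` at `k`): the torus bond identity `(u b₋)⁻¹U(b)u(b₊) = expUnit (iηA(b))` on the `SideTouches` layer of `S♯`, and the three torus-native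
bounds with thresholds LITERALLY `α₂` (`(Lᵏη)⁻¹ = 1` at the top scale): `‖A⟨y, τ⟩‖ < α₂`, `‖η⁻¹(A⟨y + e_κ, τ⟩ − A⟨y, τ⟩)‖ < α₂` on the
`SideTouches` layer and the flat `‖∂^{η*}∂^ηA♯‖ < α₂` on the `BondTouches` layer, give the `∃ Ω u A, …` clause of the socket at `x`.
[cite: Balaban1985Variational, (167)–(168) p.304; Balaban1985RegularSpaces, (1.140) p.100] -/
theorem localChart_top_of_torus (F : T3ContinuumYM3Torus.T3Family) (n K : ℕ) {α₂ : ℝ} (x : Site (F.P K) 0)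
    (U : GaugeField (F.P K) 0 (Matrix.specialUnitaryGroup (Fin 2) ℂ))
    (S : Set (Site (F.P K) 0)) (u : GaugeTransf (F.P K) 0 (Matrix.unitaryGroup (Fin 2) ℂ))
    (A : GaugeField (F.P K) 0 (Matrix (Fin 2) (Fin 2) ℂ)) (hx : x ∈ S) (hA : ∀ b : PBond (F.P K) 0, IsSelfAdjoint (A b))
    (hchart : ∀ (z : B7Prop1Explicit.Site (F.P K).d) (μ : Fin (F.P K).d),
      SideTouches (pullDom (fun j => if K - n ≤ j then S else (∅ : Set (Site (F.P K) 0))) (K - n)) z μ →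
      (Unitary.toUnits (u (transl 0 z)))⁻¹ * unitsField (B10Eq27TorusAxialLog.toUField U) ⟨transl 0 z, μ⟩ *
          Unitary.toUnits (u ((transl 0 z).shift μ)) =
        expUnit (I • ((((F.L : ℝ)⁻¹) ^ (K - n)) • A ⟨transl 0 z, μ⟩)))
    (h1 : ∀ (z : B7Prop1Explicit.Site (F.P K).d) (τ : Fin (F.P K).d),
      SideTouches (pullDom (fun j => if K - n ≤ j then S else (∅ : Set (Site (F.P K) 0))) (K - n)) z τ → ‖A ⟨transl 0 z, τ⟩‖ < α₂)
    (h2 : ∀ (z : B7Prop1Explicit.Site (F.P K).d) (κ τ : Fin (F.P K).d),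
      SideTouches (pullDom (fun j => if K - n ≤ j then S else (∅ : Set (Site (F.P K) 0))) (K - n)) z τ →
      ‖(((F.L : ℝ)⁻¹) ^ (K - n))⁻¹ • (A ⟨(transl 0 z).shift κ, τ⟩ - A ⟨transl 0 z, τ⟩)‖ < α₂)
    (h3 : ∀ (z : B7Prop1Explicit.Site (F.P K).d) (μ : Fin (F.P K).d),
      BondTouches (pullDom (fun j => if K - n ≤ j then S else (∅ : Set (Site (F.P K) 0))) (K - n)) z μ →
      ‖pdiv (((F.L : ℝ)⁻¹) ^ (K - n)) (1 : B7Prop1Explicit.Site (F.P K).d → Fin (F.P K).d → (Matrix (Fin 2) (Fin 2) ℂ)ˣ)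
          (plaqCovDeriv (((F.L : ℝ)⁻¹) ^ (K - n)) (1 : B7Prop1Explicit.Site (F.P K).d → Fin (F.P K).d → (Matrix (Fin 2) (Fin 2) ℂ)ˣ)
            (pull A 0)) μ z‖ < α₂) :
    ∃ (Ω' : ℕ → Set (Site (F.P K) 0)) (u' : GaugeTransf (F.P K) 0 (Matrix.unitaryGroup (Fin 2) ℂ))
        (A' : GaugeField (F.P K) 0 (Matrix (Fin 2) (Fin 2) ℂ)),
        x ∈ Ω' (K - n) ∧ (∀ b : PBond (F.P K) 0, IsSelfAdjoint (A' b)) ∧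
        (∀ j, j ≤ K - n → ∀ (z : B7Prop1Explicit.Site (F.P K).d) (μ : Fin (F.P K).d), SideTouches (pullDom Ω' j) z μ →
          mgauge (cfgPull (F.P K) 1) (gaugePull (F.P K) u')⁻¹ (cfgPull (F.P K) (B10Eq27TorusAxialLog.toUField U)) z μ =
            cfgExp (((F.L : ℝ)⁻¹) ^ (K - n)) (pull A' 0) z μ) ∧
        (∀ j, j ≤ K - n → Cond140 (F.P K).L (((F.L : ℝ)⁻¹) ^ (K - n)) α₂ j (pullDom Ω' j) (cfgPull (F.P K) 1) (pull A' 0)) := by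
  have h1u := topScale_inv_eq_one F n K
  refine localChart_of_torus F n K x U (fun j => if K - n ≤ j then S else ∅) u A ?_ hA ?_ ?_ ?_ ?_
  · show x ∈ (if K - n ≤ K - n then S else (∅ : Set (Site (F.P K) 0)))
    rw [if_pos le_rfl]; exact hx
  · intro j hj z μ hz
    rcases hj.lt_or_eq with hlt | rfl
    · exact absurd hz (not_sideTouches_pullDom_empty F K _ (topFam_apply_lt F n K S hlt) z μ)
    · exact hchart z μ hz
  · intro j hj z τ hz
    rcases hj.lt_or_eq with hlt | rfl
    · exact absurd hz (not_sideTouches_pullDom_empty F K _ (topFam_apply_lt F n K S hlt) z τ)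
    · rw [h1u, mul_one]; exact h1 z τ hz
  · intro j hj z κ τ hz
    rcases hj.lt_or_eq with hlt | rfl
    · exact absurd hz (not_sideTouches_pullDom_empty F K _ (topFam_apply_lt F n K S hlt) z τ)
    · rw [h1u, one_pow, mul_one]; exact h2 z κ τ hz
  · intro j hj z μ hz
    rcases hj.lt_or_eq with hlt | rfl
    · exact absurd hz (not_bondTouches_pullDom_empty F K _ (topFam_apply_lt F n K S hlt) z μ)
    · rw [h1u, one_pow, mul_one]; exact h3 z μ hz

end TopLevel

/-! ## §6 (v1.1) NON-VACUITY: the trivial configuration meets the socket's per-site clause (`u = 1`, `A = 0`) -/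

section Sanity

/-- `expUnit 0 = 1`. [folklore] -/
theorem expUnit_zero {𝔸 : Type*} [NormedRing 𝔸] [NormedAlgebra ℂ 𝔸] [CompleteSpace 𝔸] : expUnit (0 : 𝔸) = 1 := by
  ext; rw [B7Prop1Explicit.val_expUnit, NormedSpace.exp_zero, Units.val_one]

omit [NeZero N] in
/-- The flat curl of the zero one-form vanishes. [cite: Balaban1985RegularSpaces, (1.1) p.76] -/
theorem plaqCovDeriv_flat_pull_zero (η : ℝ) :
    plaqCovDeriv η (1 : B7Prop1Explicit.Site P.d → Fin P.d → (Matrix (Fin N) (Fin N) ℂ)ˣ)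
        (pull (fun _ => 0 : GaugeField P 0 (Matrix (Fin N) (Fin N) ℂ)) 0) = fun _ _ _ => 0 := by
  funext μ ν z
  rw [plaqCovDeriv_flat_pull_apply]
  simp

omit [NeZero N] in
/-- The flat divergence of the zero plaquette function vanishes. [cite: Balaban1985RegularSpaces, (1.1) p.76] -/
theorem pdiv_flat_zero (η : ℝ) (μ : Fin P.d) (z : B7Prop1Explicit.Site P.d) :
    pdiv η (1 : B7Prop1Explicit.Site P.d → Fin P.d → (Matrix (Fin N) (Fin N) ℂ)ˣ)
        (fun _ _ _ => (0 : Matrix (Fin N) (Fin N) ℂ)) μ z = 0 := by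
  rw [pdiv_flat_apply]
  simp

/-- **NON-VACUITY OF THE SOCKET's PER-SITE CLAUSE**: for the trivial configuration `U = 1`, every site `x`, every set `S ∋ x` and every
`α₂ > 0`, the clause holds with `u = 1`, `A = 0` (`(1)⁻¹·1·1 = expUnit 0`; all three letters vanish).  So the hypothesis class of
`Prop8LastMile.halvingMinimisers_of_localCharts167` is inhabited at the flat datum (where `U = 1` is the minimiser over (6) of `V = 1`).
[cite: Balaban1985Variational, (2) p.278 (the trivial configuration lies in every space (2)); Balaban1985RegularSpaces, (1.140) p.100] -/
theorem localChart_top_one (F : T3ContinuumYM3Torus.T3Family) (n K : ℕ) {α₂ : ℝ} (hα₂ : 0 < α₂) (x : Site (F.P K) 0)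
    (S : Set (Site (F.P K) 0)) (hx : x ∈ S) :
    ∃ (Ω' : ℕ → Set (Site (F.P K) 0)) (u' : GaugeTransf (F.P K) 0 (Matrix.unitaryGroup (Fin 2) ℂ))
        (A' : GaugeField (F.P K) 0 (Matrix (Fin 2) (Fin 2) ℂ)),
        x ∈ Ω' (K - n) ∧ (∀ b : PBond (F.P K) 0, IsSelfAdjoint (A' b)) ∧
        (∀ j, j ≤ K - n → ∀ (z : B7Prop1Explicit.Site (F.P K).d) (μ : Fin (F.P K).d), SideTouches (pullDom Ω' j) z μ →
          mgauge (cfgPull (F.P K) 1) (gaugePull (F.P K) u')⁻¹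
              (cfgPull (F.P K) (B10Eq27TorusAxialLog.toUField (1 : GaugeField (F.P K) 0 (Matrix.specialUnitaryGroup (Fin 2) ℂ)))) z μ =
            cfgExp (((F.L : ℝ)⁻¹) ^ (K - n)) (pull A' 0) z μ) ∧
        (∀ j, j ≤ K - n → Cond140 (F.P K).L (((F.L : ℝ)⁻¹) ^ (K - n)) α₂ j (pullDom Ω' j) (cfgPull (F.P K) 1) (pull A' 0)) := by
  refine localChart_top_of_torus F n K x 1 S (fun _ => 1) (fun _ => 0) hx (fun b => IsSelfAdjoint.zero _) (fun z μ _ => ?_)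
    (fun z τ _ => by rw [norm_zero]; exact hα₂) (fun z κ τ _ => by rw [sub_zero, smul_zero, norm_zero]; exact hα₂) (fun z μ _ => ?_)
  · rw [T3PrintedRegularMinimiser.unitsField_toUField_one, map_one, inv_one, one_mul, one_mul, smul_zero, smul_zero, expUnit_zero]
  · rw [plaqCovDeriv_flat_pull_zero, pdiv_flat_zero, norm_zero]; exact hα₂

end Sanity

end Summit.QuantumFields.YangMills.Theorems.Prop8PullbackDict

end
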